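import Mathlib
import Summits.ValiantsHypothesis.ValiantsHypothesis.Theorems.NewtonUnitEquationsTwoProductsRadixClassTransport

/-!
# Coset transport (lead c6, crux TwoProducts, line corner-log-linearization)

Abstract form of the radix class transport: for any polynomial `X`, a base point `s` of a residue
class mod `M`, a "quotient" polynomial `Y` whose coefficients are the coset coefficients of `X`
(`coeff (s + M • p) X = coeff p Y`) and the domination `s ≤ e` of the class support points `e` of `X`,
an `L`-pinned support point `e` of `X` in the class of `s` (every other support point of `X` that is
`w`-lighter than or as light as `e` lies in `L`) is transported to `e = s + M • p` with `p` a support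
point of `Y` all of whose lighter-or-equal competitors `q'` satisfy `s + M • q' ∈ L`.
-/

set_option linter.dupNamespace false

namespace Summit.ValiantsHypothesis.ValiantsHypothesis.Theorems.TwoProducts.CosetTransport

open MvPolynomial
open Summit.ValiantsHypothesis.ValiantsHypothesis.Theorems.TwoProducts.RadixClassTransport

/-- STUB `stub_cosetTransport` (line corner-log-linearization, two-product rigid radix rung).
For any polynomial `X`, a base point `s` of a residue class mod `M`, the coset identity
`coeff (s + M • p) X = coeff p Y` and the domination of `s` by the class support points of `X`:
an `L`-pinned support point `e` of `X` in the class of `s` is `s + M • p` with `p ∈ supp Y`, and every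
competitor `q' ∈ supp Y`, `q' ≠ p`, of weight at most that of `p` has `s + M • q' ∈ L`. -/
theorem stub_cosetTransport : ∀ (M : ℕ) (X Y : MvPolynomial (Fin 2) ℂ) (s : Fin 2 →₀ ℕ) (L : Finset (Fin 2 →₀ ℕ)), 1 ≤ M →
    (∀ p : Fin 2 →₀ ℕ, MvPolynomial.coeff (s + M • p) X = MvPolynomial.coeff p Y) →
    (∀ e ∈ X.support, e 0 % M = s 0 % M → e 1 % M = s 1 % M → s ≤ e) →
    ∀ (w : Fin 2 → ℤ), 0 < w 0 → 0 < w 1 → ∀ e ∈ X.support, e 0 % M = s 0 % M → e 1 % M = s 1 % M →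
    (∀ q ∈ X.support, q ≠ e → w 0 * (q 0 : ℤ) + w 1 * (q 1 : ℤ) ≤ w 0 * (e 0 : ℤ) + w 1 * (e 1 : ℤ) → q ∈ L) →
    ∃ p : Fin 2 →₀ ℕ, e = s + M • p ∧ p ∈ Y.support ∧
      ∀ q' ∈ Y.support, q' ≠ p →
        w 0 * (q' 0 : ℤ) + w 1 * (q' 1 : ℤ) ≤ w 0 * (p 0 : ℤ) + w 1 * (p 1 : ℤ) → s + M • q' ∈ L := by
  intro M X Y s L hM hcoset hdom w _ _ e he hmod0 hmod1 hpin
  obtain ⟨p, rfl⟩ : ∃ p : Fin 2 →₀ ℕ, e = s + M • p :=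
    ⟨_, eq_add_smul_of_mod_eq hmod0 hmod1 (hdom e he hmod0 hmod1)⟩
  refine ⟨p, rfl, ?_, ?_⟩
  · rw [mem_support_iff, ← hcoset]
    exact mem_support_iff.1 he
  · intro q' hq' hne hle
    have hq : s + M • q' ∈ X.support := by
      rw [mem_support_iff, hcoset]
      exact mem_support_iff.1 hq'
    have hqe : s + M • q' ≠ s + M • p := fun h => hne (smul_cancel_of_one_le hM (add_left_cancel h))
    have h := hpin _ hq hqe
    rw [wt_add_smul, wt_add_smul] at h
    exact h (add_le_add le_rfl (mul_le_mul_of_nonneg_left hle (Nat.cast_nonneg M)))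

end Summit.ValiantsHypothesis.ValiantsHypothesis.Theorems.TwoProducts.CosetTransport
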